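import Mathlib
import Summits.NavierStokesRegularity.NavierStokesRegularity.Theorems.TypeIQuarterGateScarEnvelopeTypeISatelliteTowerFixedPoint

/-!
# Satellite tower for crux `ScarEnvelopeTypeI` (stmt-NavierStokesRegularity-23843) — Part Y0–Y1: tameness is an a.e.-invariant; the TAME ROOT-RECURRENT SELF-BLOWN-UP gallery point

Part Y0–Y1 of nsreg-p3's ROUND-43 artefact (section `Recurrent`, first half): Y0 ★ `budgetAt_zero_of_ae_eq` (TAMENESS is an a.e.-invariant among
fields continuous on the open past); Y1 ★★ `ABTower.tameRecurrent_or_selfDescending` — LEAD ns-sz-p1 g6's Birkhoff dichotomy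
(`ABTower.envelopedLeaf_or_selfDescending`, `…SatelliteTowerGalleryNormalForm`) re-run with the discarded tame point KEPT: a TAME, ROOT-RECURRENT,
SELF ROOT-BLOWN-UP gallery point ∨ the self-descending point (proof text = sz-p1's, credit/lineage ns-sz-p1 g6).

PROVENANCE: declaration texts VERBATIM from the HOME artefact of the instrument seat nsreg-p3 g27 (cell `pub/ns-regularity-ideate`):
`round-43/Enemy43.lean` (sha16 `f4e9849cbe2eaa96`, NEW part `partY.lean` f195bf0010977c73 = partY1/partY2/partY3; a module written
against the TREE; memo `round-43/ROUND-43.md` bdd83fd98f0e4a52), scored by referee ref3 g27 (`SCORE-p3-ROUND-43-0828.md`); the author cannot write under `Theorems/`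
(`perm.theorems-prover-only`); landed by the prover ns-es-p1 g5 as landing hand of record (director-ns DIRECTOR-NS #237 (3)), split into
≤ 400-line modules, `E3` spelled out, the artefact's `#guard_msgs … #print axioms` certificates not landed.
`--supports stmt-NavierStokesRegularity-23843 --as helper`.

HONEST FRAMING: instrument theorems about HYPOTHETICAL Type-I zoom limits (Albritton–Barker objects of the census of crux
`TypeIQuarterGate.ScarEnvelopeTypeI`, item 23843); the analytic input is the tree's closure engine (compactness
`local_typeI_compactness_twin_inBall`, sharpened to constant 1 in Part S1; Q1 whole-space), P1 rate inheritance, L8 persistence and the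
tree's PROVED small-constant Liouville theorem; Parts R/S are order theory on the re-classing and closure lemmas.  NOTHING OPEN IS
PROVED: 23843, (L′) `TypeILiouvilleAB` / (L′₀), the GLOBAL (S∞) = `CritAttained`, (M𝐈₁), (E1⁺), (E2ᵣ), route ExtremalTypeIConstant's
cruxes, N0 and Navier–Stokes regularity are OPEN; `critRate`, `levelCrit I`, `liouvilleRate` are `sInf`s that are `0` by junk value
when the defining set is empty (every statement using them carries the nonemptiness hypothesis explicitly).
-/

-- the summit-side namespace repeats a component by design (single-conjunct summit, D-0017)
set_option linter.dupNamespace false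

open MeasureTheory Set Metric Filter Topology
open scoped ENNReal NNReal InnerProductSpace
open Literature.Analysis.FluidPDE

namespace Summit.NavierStokesRegularity.NavierStokesRegularity.Cruxes.ScarEnvelopeTypeI.ZoomDictionary

section Recurrent

variable {U : ℝ → (EuclideanSpace ℝ (Fin 3)) → (EuclideanSpace ℝ (Fin 3))} {P : ℝ → (EuclideanSpace ℝ (Fin 3)) → ℝ} {H : ℝ → (EuclideanSpace ℝ (Fin 3)) → (EuclideanSpace ℝ (Fin 3)) →L[ℝ] (EuclideanSpace ℝ (Fin 3))} {M : ℝ}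

/-! ### Y0. Tameness is an invariant of a.e.-equality among fields continuous on the open past -/

/-- **Y0.** `BudgetAt 1 0 · 0` (tameness at the root) only reads the time slices `t ∈ (-δ, 0)` on small
annuli; two fields continuous on the open past and a.e. equal on every `Q_R(0)`, `R < 1`, agree pointwise on
`Q_{1/2}(0)` (`eqOn_cylinder_of_ae_eq`), so the budget transfers (shrink `δ ≤ 1/4`, `r₀ ≤ 1/8`, `e/8 < 1/2`). -/
theorem budgetAt_zero_of_ae_eq {U₁ U₂ : ℝ → (EuclideanSpace ℝ (Fin 3)) → (EuclideanSpace ℝ (Fin 3))}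
    (h₁ : ContinuousOn (Function.uncurry U₁) (Iio 0 ×ˢ univ))
    (h₂ : ContinuousOn (Function.uncurry U₂) (Iio 0 ×ˢ univ))
    (hae : ∀ R ∈ Ioo (0 : ℝ) 1,
      ∀ᵐ z ∂(volume.restrict (parabolicCylinder R (0 : ℝ × (EuclideanSpace ℝ (Fin 3))))), U₁ z.1 z.2 = U₂ z.1 z.2)
    (hb : BudgetAt 1 0 U₁ 0) : BudgetAt 1 0 U₂ 0 := by
  obtain ⟨q, δ, r₀, hδ, hr₀, hB⟩ := hb
  have hEq := eqOn_cylinder_of_ae_eq h₁ h₂ hae (R := 1 / 2) ⟨by norm_num, by norm_num⟩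
  refine ⟨q, min δ (1 / 4), min r₀ (1 / 8), lt_min hδ (by norm_num), lt_min hr₀ (by norm_num),
    fun t ht ℓ hℓ1 hℓ2 => ?_⟩
  have hδ' : min δ (1 / 4) ≤ δ := min_le_left _ _
  have h14 : min δ (1 / 4) ≤ 1 / 4 := min_le_right _ _
  have ht' : t ∈ Ioo (0 - δ) 0 := ⟨by linarith [ht.1], ht.2⟩
  have h1 := hB t ht' ℓ hℓ1 (hℓ2.trans (min_le_left _ _))
  have hℓ8 : ℓ ≤ 1 / 8 := hℓ2.trans (min_le_right _ _)
  have hcube : octaveCube U₂ 0 ℓ t = octaveCube U₁ 0 ℓ t := by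
    unfold octaveCube
    refine setLIntegral_congr_fun (measurableSet_octAnn 0 ℓ) fun y hy => ?_
    have hy2 : ‖y - 0‖ < Real.exp 1 * ℓ := hy.2
    rw [sub_zero] at hy2
    have hmem : ((t, y) : ℝ × (EuclideanSpace ℝ (Fin 3))) ∈ parabolicCylinder (1 / 2) (0 : ℝ × (EuclideanSpace ℝ (Fin 3))) := by
      rw [mem_parabolicCylinder]
      change ((0 : ℝ) - (1 / 2) ^ 2 < t ∧ t < 0) ∧ dist y (0 : (EuclideanSpace ℝ (Fin 3))) < 1 / 2
      refine ⟨⟨by linarith [ht.1], ht.2⟩, ?_⟩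
      rw [dist_zero_right]
      have he : Real.exp 1 < 2.7182818286 := Real.exp_one_lt_d9
      nlinarith [Real.exp_pos 1]
    have := hEq hmem
    simp only [Function.uncurry_apply_pair] at this
    show ‖U₂ t y‖ₑ ^ (3 : ℝ) = ‖U₁ t y‖ₑ ^ (3 : ℝ)
    rw [this]
  rw [hcube]
  exact h1

/-! ### Y1. The root dichotomy with recurrence — the tame branch kept (LEAD sz-p1's proof) -/

/-- ★★ **Y1. LEAD ns-sz-p1 g6's ROOT DICHOTOMY WITH RECURRENCE (`ABTower.envelopedLeaf_or_selfDescending`,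
p653175), THE TAME BRANCH KEPT.**  The tree theorem exports its tame alternative only as «an enveloped leaf of
rate `M` exists», discarding the point of the Birkhoff minimal set that produced it.  This is the SAME proof
(verbatim, LEAD lineage; one case rewritten) with the tame alternative exported IN FULL: a ROOTED A–B object `n`
of class `M`, TAME at its root, which is a SELF ROOT BLOW-UP (`RootBlowup n n`: a.e. on the unit window a
tangent flow of itself at its own root), ROOT-RECURRENT (`IsRootOmegaLimit n.U n.U`), a gallery limit of `U`
with budget `≤ 4·𝐈(U)`, and an exact globally equi-rated minimiser of the gallery (class `ABTower m⋆`, all scars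
exactly `m⋆`-rated, `m⋆` gallery-minimal).  The other alternative is the tree's self-descending node, untouched. -/
theorem ABTower.tameRecurrent_or_selfDescending (hU : ABTower M U P H) (h0 : ¬ RegPt U 0) :
    (∃ n : TNode, RootObj M n ∧ TameRoot n ∧ RootBlowup n n ∧
      IsGalleryLimit U n.U ∧
      typeIBound (Iio (0 : ℝ) ×ˢ univ) n.U n.P n.H ≤ 4 * typeIBound (Iio (0 : ℝ) ×ˢ univ) U P H ∧
      IsRootOmegaLimit n.U n.U ∧
      ∃ mstar : ℝ, ABTower mstar n.U n.P n.H ∧ mstar ≤ tightRate U 0 ∧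
        (∀ y : (EuclideanSpace ℝ (Fin 3)), ¬ RegPt n.U y → tightRate n.U y = mstar) ∧
        ∀ (W₂ : ℝ → (EuclideanSpace ℝ (Fin 3)) → (EuclideanSpace ℝ (Fin 3))) (P₂ : ℝ → (EuclideanSpace ℝ (Fin 3)) → ℝ)
          (H₂ : ℝ → (EuclideanSpace ℝ (Fin 3)) → (EuclideanSpace ℝ (Fin 3)) →L[ℝ] (EuclideanSpace ℝ (Fin 3)))
          (y₂ : (EuclideanSpace ℝ (Fin 3))),
          ABTower M W₂ P₂ H₂ → IsGalleryLimit U W₂ → ¬ RegPt W₂ y₂ → mstar ≤ tightRate W₂ y₂) ∨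
    ∃ n : TNode, RootObj M n ∧ ¬ TameRoot n ∧ RootDescends n n ∧
      IsGalleryLimit U n.U ∧
      typeIBound (Iio (0 : ℝ) ×ˢ univ) n.U n.P n.H ≤ 4 * typeIBound (Iio (0 : ℝ) ×ˢ univ) U P H ∧
      IsRootOmegaLimit n.U n.U ∧
      ∃ mstar : ℝ, ABTower mstar n.U n.P n.H ∧ mstar ≤ tightRate U 0 ∧
        (∀ y : (EuclideanSpace ℝ (Fin 3)), ¬ RegPt n.U y → tightRate n.U y = mstar) ∧
        ∀ (W₂ : ℝ → (EuclideanSpace ℝ (Fin 3)) → (EuclideanSpace ℝ (Fin 3))) (P₂ : ℝ → (EuclideanSpace ℝ (Fin 3)) → ℝ)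
          (H₂ : ℝ → (EuclideanSpace ℝ (Fin 3)) → (EuclideanSpace ℝ (Fin 3)) →L[ℝ] (EuclideanSpace ℝ (Fin 3)))
          (y₂ : (EuclideanSpace ℝ (Fin 3))),
          ABTower M W₂ P₂ H₂ → IsGalleryLimit U W₂ → ¬ RegPt W₂ y₂ → mstar ≤ tightRate W₂ y₂ := by
  classical
  have hUmeas : ∀ R : ℝ, 0 < R → AEStronglyMeasurable (Function.uncurry U)
      (volume.restrict (parabolicCylinder R (0 : ℝ × (EuclideanSpace ℝ (Fin 3))))) :=
    fun R hR => hU.aestronglyMeasurable_uncurry hR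
  -- ## the exact minimiser and the phase space at its rate `m⋆`
  obtain ⟨W₀, P₀, H₀, mstar, hW₀, hW₀m, hg₀, hI₀, hs₀, hmU, -, -, hmin⟩ :=
    hU.exists_galleryExactMinimiser h0
  have hphase₀ : ExactPhase M mstar U P H W₀ := ⟨⟨P₀, H₀, hW₀, hI₀⟩, hW₀m.1.2.2.2, hg₀, hs₀⟩
  letI : PseudoMetricSpace (PhasePt M mstar U P H) := PhasePt.pseudoMetricSpace M mstar U P H
  haveI : Nonempty (PhasePt M mstar U P H) := ⟨⟨W₀, hphase₀⟩⟩
  have hdist : ∀ a b : PhasePt M mstar U P H, dist a b = galleryDist a.W b.W := fun a b => rfl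
  have hseq : IsSeqCompact (univ : Set (PhasePt M mstar U P H)) := by
    intro x _
    obtain ⟨W', σ, hσ, hW', hconv⟩ := ExactPhase.exists_seqLimit hU (fun j => (x j).mem)
    refine ⟨⟨W', hW'⟩, mem_univ _, σ, hσ, ?_⟩
    rw [tendsto_iff_dist_tendsto_zero]
    simp only [Function.comp_apply, hdist]
    exact tendsto_galleryDist_of_tendsto hconv
  haveI : CompactSpace (PhasePt M mstar U P H) := ⟨isCompact_iff_isSeqCompact.2 hseq⟩
  -- ## the root-zoom semiflow and a Birkhoff minimal set
  set T : ℝ → PhasePt M mstar U P H → PhasePt M mstar U P H :=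
    fun l a => if hl : 0 < l then ⟨zoom a.W 0 0 l, a.mem.rootZoom hl⟩ else a with hTdef
  have hTpos : ∀ {l : ℝ} (hl : 0 < l) (a : PhasePt M mstar U P H),
      T l a = ⟨zoom a.W 0 0 l, a.mem.rootZoom hl⟩ := fun hl a => by
    simp only [hTdef, dif_pos hl]
  have hcont : ∀ l : ℝ, 0 < l → l ≤ 1 → Continuous (T l) := by
    intro l hl hl1
    set K : ℝ := max 1 (‖l‖ₑ * (ENNReal.ofReal (l ^ 2 * l ^ 3)⁻¹) ^ (1 / (3 : ℝ≥0∞).toReal)).toReal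
      with hKdef
    have hK : 0 ≤ K := le_max_of_le_left zero_le_one
    refine (LipschitzWith.of_dist_le_mul (K := K.toNNReal) fun a b => ?_).continuous
    rw [hTpos hl, hTpos hl, hdist, hdist, Real.coe_toNNReal _ hK]
    exact galleryDist_rootZoom_le a.mem.l3loc b.mem.l3loc hl hl1
  have hmul : ∀ l μ : ℝ, 0 < l → l ≤ 1 → 0 < μ → μ ≤ 1 →
      ∀ a : PhasePt M mstar U P H, T l (T μ a) = T (l * μ) a := by
    intro l μ hl _ hμ _ a
    rw [hTpos hμ, hTpos hl, hTpos (mul_pos hl hμ)]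
    congr 1
    rw [zoom_zoom_centre, smul_zero, add_zero, mul_comm]
  obtain ⟨Mset, hMne, hMcl, hMinv, hMomega⟩ := exists_minimal_set T hcont hmul
  have hkpos : ∀ k : ℕ, (0 : ℝ) < 1 / ((k : ℝ) + 1) := fun k => by positivity
  -- recurrence of every point of the minimal set, in gallery terms
  have hrec : ∀ b ∈ Mset, ∃ l : ℕ → ℝ, (∀ k, 0 < l k) ∧ Tendsto l atTop (𝓝 0) ∧
      ZoomsTendsto b.W (fun _ => 0) l b.W := by
    intro b hb
    have hbω : ∀ k : ℕ, b ∈ closure {y : PhasePt M mstar U P H |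
        ∃ l : ℝ, 0 < l ∧ l ≤ 1 / ((k : ℝ) + 1) ∧ y = T l b} := fun k => by
      have h := hb
      rw [← hMomega b hb] at h
      exact mem_iInter.1 h k
    have hret : ∀ k : ℕ, ∃ l : ℝ, 0 < l ∧ l ≤ 1 / ((k : ℝ) + 1) ∧
        galleryDist (zoom b.W 0 0 l) b.W < 1 / ((k : ℝ) + 1) := by
      intro k
      obtain ⟨y, ⟨l, hl, hlk, rfl⟩, hd⟩ := Metric.mem_closure_iff.1 (hbω k) _ (hkpos k)
      refine ⟨l, hl, hlk, ?_⟩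
      rwa [hdist, hTpos hl, galleryDist_comm] at hd
    choose l hl hlk hld using hret
    have hl0 : Tendsto l atTop (𝓝 0) :=
      squeeze_zero (fun k => (hl k).le) hlk tendsto_one_div_add_atTop_nhds_zero_nat
    have hdl : Tendsto (fun k => galleryDist (zoom b.W 0 0 (l k)) b.W) atTop (𝓝 0) :=
      squeeze_zero (fun k => galleryDist_nonneg _ _) (fun k => (hld k).le)
        tendsto_one_div_add_atTop_nhds_zero_nat
    exact ⟨l, hl, hl0, fun R hR =>
      tendsto_of_tendsto_galleryDist (fun k => (b.mem.rootZoom (hl k)).l3loc) b.mem.l3loc hdl hR⟩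
  -- ## the dichotomy on the minimal set
  by_cases hα : ∃ a ∈ Mset, BudgetAt 1 0 a.W 0
  · -- (α) a TAME point of the minimal set: exported WITH its recurrence and its self root blow-up
    obtain ⟨a, haM, hb⟩ := hα
    obtain ⟨⟨Pa, Ha, hABa, hIa⟩, hdeca, hga, hsa⟩ := a.mem
    left
    obtain ⟨l, hl, hl0, hzt⟩ := hrec a haM
    have hωa : IsRootOmegaLimit a.W a.W := ⟨a.mem.l3loc, l, hl, hl0, hzt⟩
    -- a tangent flow along a subsequence of the return scales is a.e. the field itself
    obtain ⟨φ, hφ, Ūa, hŪa⟩ := exists_tangentU_along (towerObj_of_abTower hABa) 0 hl hl0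
    have haea : ∀ R ∈ Ioo (0 : ℝ) 1,
        ∀ᵐ w ∂(volume.restrict (parabolicCylinder R (0 : ℝ × (EuclideanSpace ℝ (Fin 3))))),
          Ūa w.1 w.2 = a.W w.1 w.2 := by
      intro R hR
      obtain ⟨-, -, pa, hTRa⟩ := hŪa
      obtain ⟨-, hŪamem, hconva, -⟩ := hTRa R hR
      have hmeasv : ∀ j, AEStronglyMeasurable (Function.uncurry (zoom a.W 0 0 ((l ∘ φ) j)))
          (volume.restrict (parabolicCylinder R (0 : ℝ × (EuclideanSpace ℝ (Fin 3))))) := fun j =>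
        aestronglyMeasurable_zoom_of_inBall hABa.2.1 0 (hl _) hR.1
      have h := ae_eq_of_tendsto_eLpNorm_three hmeasv hŪamem.1 (a.mem.l3loc R hR.1).1 hconva
        ((hzt R hR.1).comp hφ.tendsto_atTop)
      exact h.mono fun w hw => hw
    have hscara : ∀ y : (EuclideanSpace ℝ (Fin 3)), ¬ RegPt a.W y → tightRate a.W y = mstar :=
      fun y hy => le_antisymm (tightRate_le_of_rateAt (rateAt_of_hasTypeITimeDecay hdeca y))
        (hmin a.W Pa Ha y hABa hga hy)
    have hABam : ABTower mstar a.W Pa Ha :=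
      ⟨⟨hABa.1.1, hABa.1.2.1, hABa.1.2.2.1, hdeca⟩, hABa.2.1, hABa.2.2.1, hABa.2.2.2⟩
    exact ⟨⟨a.W, Pa, Ha, 0⟩, ⟨hABa, hsa⟩, hb, ⟨l ∘ φ, Ūa, hŪa, haea⟩, hga, hIa, hωa, mstar, hABam,
      hmU, hscara, hmin⟩
  · -- (β) no tame point
    push Not at hα
    right
    obtain ⟨a, haM⟩ := hMne
    obtain ⟨⟨Pa, Ha, hABa, hIa⟩, hdeca, hga, hsa⟩ := a.mem
    -- the root meter: a sphere scar on a root tangent of `a`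
    obtain ⟨L, Ū, hŪ, z, hz, hzsing⟩ :=
      (hABa.not_budgetAt_iff_sphere 0 (by norm_num : (1 : ℝ) < 4)).1 (hα a haM)
    obtain ⟨hLpos, hL0, pbar, hTR⟩ := hŪ
    have hz4 : ‖z‖ = 1 / 4 := by rw [hz]; norm_num
    have hz1 : ‖z‖ < 1 := by rw [hz4]; norm_num
    have hz0 : z ≠ 0 := by
      intro hz0'
      rw [hz0', norm_zero] at hz4
      norm_num at hz4
    -- a root ω-limit `W₁` of `a.W` along a subsequence of `L`, a.e. equal to `Ū` on `Q_R`, `R < 1`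
    obtain ⟨W₁, P₁, H₁, σ, hσ, hW₁, -, hω₁, hconv₁⟩ := hABa.exists_isRootOmegaLimit hLpos hL0
    have hae₁ : ∀ R ∈ Ioo (0 : ℝ) 1,
        ∀ᵐ w ∂(volume.restrict (parabolicCylinder R (0 : ℝ × (EuclideanSpace ℝ (Fin 3))))),
          Ū w.1 w.2 = W₁ w.1 w.2 := by
      intro R hR
      obtain ⟨-, hŪmem, hconvŪ, -⟩ := hTR R hR
      have hmeasv : ∀ j, AEStronglyMeasurable (Function.uncurry (zoom a.W 0 0 (L (σ j))))
          (volume.restrict (parabolicCylinder R (0 : ℝ × (EuclideanSpace ℝ (Fin 3))))) := fun j =>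
        aestronglyMeasurable_zoom_of_inBall hABa.2.1 0 (hLpos _) hR.1
      have h := ae_eq_of_tendsto_eLpNorm_three hmeasv hŪmem.1 (hω₁.1 R hR.1).1
        (hconvŪ.comp hσ.tendsto_atTop) (hconv₁ R hR.1)
      exact h.mono fun w hw => hw
    have hW₁z : ¬ RegPt W₁ z := fun hr => hzsing ((regPt_iff_of_ae_eq_of_norm_lt_one hae₁ hz1).2 hr)
    -- its exact-minimiser representative `W₂`: a point `b` of the phase space
    have hgW₁ : IsGalleryLimit U W₁ := hga.trans hUmeas hω₁.isGalleryLimit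
    obtain ⟨W₂, P₂, H₂, hAB₂, hI₂, hae₂⟩ := abTower_of_isGalleryLimit hU hgW₁
    obtain ⟨U₁, -, -, -, -, hae₁', hU₁0⟩ := abTower_of_isRootOmegaLimit hABa hsa hω₁
    have hW₁0 : ¬ RegPt W₁ 0 := fun hr => hU₁0 (regPt_zero_of_ae_eq hr hae₁')
    have hs₂ : ¬ RegPt W₂ 0 := fun hr =>
      hW₁0 (regPt_zero_of_ae_eq hr fun R hR => (hae₂ R hR).mono fun w hw => hw.symm)
    have hcont₂ : ContinuousOn (Function.uncurry W₂) (Iio 0 ×ˢ univ) := (towerObj_of_abTower hAB₂).2.1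
    have hdec₂ : HasTypeITimeDecay mstar W₂ := by
      refine hasTypeITimeDecay_of_ae_rate hcont₂ fun R hR => ?_
      filter_upwards [globalRate_ae_of_isRootOmegaLimit (unitRate_of_hasTypeITimeDecay hdeca)
        (fun R hR => hABa.aestronglyMeasurable_uncurry hR) hω₁ hR, hae₂ R hR] with w hw hww
      rw [← hww]
      exact hw
    have hg₂ : IsGalleryLimit U W₂ := hgW₁.congr_ae hae₂
    have hphase₂ : ExactPhase M mstar U P H W₂ := ⟨⟨P₂, H₂, hAB₂, hI₂⟩, hdec₂, hg₂, hs₂⟩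
    set b : PhasePt M mstar U P H := ⟨W₂, hphase₂⟩ with hbdef
    -- `b` lies in the minimal set: it is a limit of root zooms of `a` with vanishing scales
    have hbM : b ∈ Mset := by
      rw [← hMomega a haM]
      refine mem_iInter.2 fun k => ?_
      have hconv₂ : ∀ R : ℝ, 0 < R → Tendsto (fun j => eLpNorm
          (Function.uncurry (zoom a.W 0 0 (L (σ j))) - Function.uncurry W₂) 3
          (volume.restrict (parabolicCylinder R (0 : ℝ × (EuclideanSpace ℝ (Fin 3)))))) atTop (𝓝 0) := by
        intro R hR
        refine (hconv₁ R hR).congr fun j => eLpNorm_congr_ae ?_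
        refine (hae₂ R hR).mono fun w hw => ?_
        have hw' : Function.uncurry W₁ w = Function.uncurry W₂ w := hw
        simp only [Pi.sub_apply, hw', Function.comp_apply]
      have htend : Tendsto (fun j => T (L (σ j)) a) atTop (𝓝 b) := by
        rw [tendsto_iff_dist_tendsto_zero]
        have e : (fun j => dist (T (L (σ j)) a) b) = fun j => galleryDist (zoom a.W 0 0 (L (σ j))) W₂ := by
          funext j
          rw [hTpos (hLpos _), hdist]
        rw [e]
        exact tendsto_galleryDist_of_tendsto hconv₂
      refine mem_closure_of_tendsto htend ?_
      have hev : ∀ᶠ j in atTop, L (σ j) ≤ 1 / ((k : ℝ) + 1) :=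
        (hL0.comp hσ.tendsto_atTop).eventually (Iic_mem_nhds (hkpos k))
      exact hev.mono fun j hj => ⟨L (σ j), hLpos _, hj, rfl⟩
    -- `b` is recurrent: return scales `l`
    obtain ⟨l, hl, hl0, hzt⟩ := hrec b hbM
    have hωb : IsRootOmegaLimit W₂ W₂ := ⟨hphase₂.l3loc, l, hl, hl0, hzt⟩
    -- a tangent flow along a subsequence of the return scales is a.e. the field itself
    obtain ⟨φ, hφ, Ūb, hŪb⟩ := exists_tangentU_along (towerObj_of_abTower hAB₂) 0 hl hl0
    have haeb : ∀ R ∈ Ioo (0 : ℝ) 1,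
        ∀ᵐ w ∂(volume.restrict (parabolicCylinder R (0 : ℝ × (EuclideanSpace ℝ (Fin 3))))),
          Ūb w.1 w.2 = W₂ w.1 w.2 := by
      intro R hR
      obtain ⟨-, -, pb, hTRb⟩ := hŪb
      obtain ⟨-, hŪbmem, hconvb, -⟩ := hTRb R hR
      have hmeasv : ∀ j, AEStronglyMeasurable (Function.uncurry (zoom W₂ 0 0 ((l ∘ φ) j)))
          (volume.restrict (parabolicCylinder R (0 : ℝ × (EuclideanSpace ℝ (Fin 3))))) := fun j =>
        aestronglyMeasurable_zoom_of_inBall hAB₂.2.1 0 (hl _) hR.1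
      have h := ae_eq_of_tendsto_eLpNorm_three hmeasv hŪbmem.1 (hphase₂.l3loc R hR.1).1 hconvb
        ((hzt R hR.1).comp hφ.tendsto_atTop)
      exact h.mono fun w hw => hw
    have hW₂z : ¬ RegPt W₂ z := fun hr =>
      hW₁z ((regPt_iff_of_ae_eq_of_norm_lt_one (fun R hR => hae₂ R hR.1) hz1).2 hr)
    -- ## the self-descending node
    have hscar : ∀ y : (EuclideanSpace ℝ (Fin 3)), ¬ RegPt W₂ y → tightRate W₂ y = mstar := fun y hy =>
      le_antisymm (tightRate_le_of_rateAt (rateAt_of_hasTypeITimeDecay hdec₂ y))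
        (hmin W₂ P₂ H₂ y hAB₂ hg₂ hy)
    have hAB₂m : ABTower mstar W₂ P₂ H₂ :=
      ⟨⟨hAB₂.1.1, hAB₂.1.2.1, hAB₂.1.2.2.1, hdec₂⟩, hAB₂.2.1, hAB₂.2.2.1, hAB₂.2.2.2⟩
    refine ⟨⟨W₂, P₂, H₂, z⟩, ⟨hAB₂, hs₂⟩, hα b hbM, ⟨l ∘ φ, Ūb, hŪb, haeb, hz4, hz0, hW₂z⟩,
      hg₂, hI₂, hωb, mstar, hAB₂m, hmU, hscar, hmin⟩

end Recurrent

end Summit.NavierStokesRegularity.NavierStokesRegularity.Cruxes.ScarEnvelopeTypeI.ZoomDictionary
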